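import Mathlib.Probability.Moments.Variance

/-!
# Amplitude transfer — probability bookkeeping

Elementary facts about sequences of random variables `X N` on probability spaces `(Ω N, P N)`
used by the Vitali amplitude transfer (route `VitaliAmplitudeTransfer`, item `AmplitudeTransfer`):

* `eq_of_tendsto_measure_lt_norm_sub` — limits in probability are unique (deterministic limits);
* `tendsto_integral_of_tendsto_measure` — convergence in probability plus vanishing variance gives
  convergence of the means;
* `tendsto_measure_lt_abs_sub_of_evariance_le` — Bienaymé–Chebyshev: an `O(1/(N+1))` variance
  bound plus convergence of the means gives convergence in probability;
* `abs_integral_sub_mul_sub_le` — the Cauchy–Schwarz bound `|Cov(X,Y)| ≤ √Var X · √Var Y`.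
-/

open MeasureTheory ProbabilityTheory Filter Topology
open scoped ENNReal NNReal

namespace Summit.AtomisticToContinuum.HydrodynamicLimit.Theorems.AmplitudeTransfer

variable {Ω : ℕ → Type*} [∀ N, MeasurableSpace (Ω N)]

/-- On a probability space, two events each of probability `< 1/2` do not cover the space. -/
theorem exists_not_mem_of_measure_lt_half {α : Type*} [MeasurableSpace α] {μ : Measure α}
    [IsProbabilityMeasure μ] {s t : Set α} (hs : μ s < 1 / 2) (ht : μ t < 1 / 2) :
    ∃ ω, ω ∉ s ∧ ω ∉ t := by
  by_contra h
  push Not at h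
  have hcover : (Set.univ : Set α) ⊆ s ∪ t := fun ω _ => by
    by_cases hω : ω ∈ s
    · exact Or.inl hω
    · exact Or.inr (h ω hω)
  have h1 : (1 : ℝ≥0∞) ≤ μ s + μ t :=
    calc (1 : ℝ≥0∞) = μ Set.univ := measure_univ.symm
      _ ≤ μ (s ∪ t) := measure_mono hcover
      _ ≤ μ s + μ t := measure_union_le s t
  have h2 : μ s + μ t < 1 / 2 + 1 / 2 := ENNReal.add_lt_add hs ht
  rw [ENNReal.add_halves] at h2
  exact absurd (lt_of_le_of_lt h1 h2) (lt_irrefl _)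

/-- **Limits in probability are unique** (deterministic limits, probability measures): if
`P_N(ε < ‖X_N - a‖) → 0` and `P_N(ε < ‖X_N - b‖) → 0` for every `ε > 0`, then `a = b`. -/
theorem eq_of_tendsto_measure_lt_norm_sub {E : Type*} [NormedAddCommGroup E]
    {P : (N : ℕ) → Measure (Ω N)} [∀ N, IsProbabilityMeasure (P N)]
    {X : (N : ℕ) → Ω N → E} {a b : E}
    (ha : ∀ ε > (0 : ℝ), Tendsto (fun N => P N {ω | ε < ‖X N ω - a‖}) atTop (𝓝 0))
    (hb : ∀ ε > (0 : ℝ), Tendsto (fun N => P N {ω | ε < ‖X N ω - b‖}) atTop (𝓝 0)) : a = b := by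
  by_contra hab
  have hpos : 0 < ‖a - b‖ := norm_pos_iff.2 (sub_ne_zero.2 hab)
  set ε : ℝ := ‖a - b‖ / 3 with hε
  have hε0 : 0 < ε := by positivity
  have hhalf : (0 : ℝ≥0∞) < 1 / 2 := by norm_num
  have hA := (ha ε hε0).eventually (gt_mem_nhds hhalf)
  have hB := (hb ε hε0).eventually (gt_mem_nhds hhalf)
  obtain ⟨N, hN⟩ := (hA.and hB).exists
  obtain ⟨ω, hωa, hωb⟩ := exists_not_mem_of_measure_lt_half hN.1 hN.2
  simp only [Set.mem_setOf_eq, not_lt] at hωa hωb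
  have : ‖a - b‖ ≤ 2 * ε :=
    calc ‖a - b‖ = ‖(X N ω - b) - (X N ω - a)‖ := by congr 1; abel
      _ ≤ ‖X N ω - b‖ + ‖X N ω - a‖ := norm_sub_le _ _
      _ ≤ ε + ε := add_le_add hωb hωa
      _ = 2 * ε := by ring
  rw [hε] at this
  linarith

/-- Real-valued form of `eq_of_tendsto_measure_lt_norm_sub` (with `|·|`). -/
theorem eq_of_tendsto_measure_lt_abs_sub
    {P : (N : ℕ) → Measure (Ω N)} [∀ N, IsProbabilityMeasure (P N)]
    {X : (N : ℕ) → Ω N → ℝ} {a b : ℝ}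
    (ha : ∀ ε > (0 : ℝ), Tendsto (fun N => P N {ω | ε < |X N ω - a|}) atTop (𝓝 0))
    (hb : ∀ ε > (0 : ℝ), Tendsto (fun N => P N {ω | ε < |X N ω - b|}) atTop (𝓝 0)) : a = b :=
  eq_of_tendsto_measure_lt_norm_sub (X := X) (fun ε hε => by simpa [Real.norm_eq_abs] using ha ε hε)
    (fun ε hε => by simpa [Real.norm_eq_abs] using hb ε hε)

/-- **Means converge when the variables converge in probability with vanishing variance.**
If the `X N` are square integrable, `Var(X_N) → 0` and `X_N → c` in probability, then
`E[X_N] → c`. -/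
theorem tendsto_integral_of_tendsto_measure
    {P : (N : ℕ) → Measure (Ω N)} [∀ N, IsProbabilityMeasure (P N)]
    {X : (N : ℕ) → Ω N → ℝ} {c : ℝ} (hX : ∀ N, MemLp (X N) 2 (P N))
    (hvar : Tendsto (fun N => variance (X N) (P N)) atTop (𝓝 0))
    (hprob : ∀ ε > (0 : ℝ), Tendsto (fun N => P N {ω | ε < |X N ω - c|}) atTop (𝓝 0)) :
    Tendsto (fun N => ∫ ω, X N ω ∂P N) atTop (𝓝 c) := by
  rw [Metric.tendsto_atTop]
  intro ε hε
  set η : ℝ := ε / 3 with hη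
  have hη0 : 0 < η := by positivity
  have hhalf : (0 : ℝ≥0∞) < 1 / 2 := by norm_num
  -- Chebyshev: `P_N(η ≤ |X_N - E X_N|) ≤ Var / η² → 0`
  have hcheb : Tendsto (fun N => P N {ω | η ≤ |X N ω - ∫ ω', X N ω' ∂P N|}) atTop (𝓝 0) := by
    have hrate : Tendsto (fun N => ENNReal.ofReal (variance (X N) (P N) / η ^ 2)) atTop (𝓝 0) := by
      have h := ENNReal.tendsto_ofReal (hvar.div_const (η ^ 2))
      rwa [zero_div, ENNReal.ofReal_zero] at h
    refine tendsto_of_tendsto_of_tendsto_of_le_of_le tendsto_const_nhds hrate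
      (fun N => zero_le) (fun N => ?_)
    exact meas_ge_le_variance_div_sq (hX N) hη0
  have hA := hcheb.eventually (gt_mem_nhds hhalf)
  have hB := (hprob η hη0).eventually (gt_mem_nhds hhalf)
  obtain ⟨N₀, hN₀⟩ := eventually_atTop.1 (hA.and hB)
  refine ⟨N₀, fun N hN => ?_⟩
  obtain ⟨ω, hω1, hω2⟩ := exists_not_mem_of_measure_lt_half (hN₀ N hN).1 (hN₀ N hN).2
  simp only [Set.mem_setOf_eq, not_le, not_lt] at hω1 hω2
  rw [Real.dist_eq]
  calc |∫ ω', X N ω' ∂P N - c| = |(X N ω - c) - (X N ω - ∫ ω', X N ω' ∂P N)| := by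
          congr 1; ring
    _ ≤ |X N ω - c| + |X N ω - ∫ ω', X N ω' ∂P N| := abs_sub _ _
    _ < η + η := add_lt_add_of_le_of_lt hω2 hω1
    _ < ε := by rw [hη]; linarith

/-- An `ℝ≥0∞`-variance bound `(N+1)·eVar ≤ C` makes the variable square integrable and bounds
its real variance by `C/(N+1)` (`C ≥ 0`). -/
theorem memLp_two_and_variance_le_of_evariance_le {α : Type*} [MeasurableSpace α]
    {μ : Measure α} [IsProbabilityMeasure μ] {X : α → ℝ} (hXm : AEStronglyMeasurable X μ)
    {C : ℝ} (hC : 0 ≤ C) (N : ℕ)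
    (h : ((N : ℝ≥0∞) + 1) * evariance X μ ≤ ENNReal.ofReal C) :
    MemLp X 2 μ ∧ variance X μ ≤ C / ((N : ℝ) + 1) := by
  have hN : (0 : ℝ≥0∞) < (N : ℝ≥0∞) + 1 := by positivity
  have hN' : ((N : ℝ≥0∞) + 1) ≠ ⊤ := by simp
  have hev : evariance X μ ≤ ENNReal.ofReal C / ((N : ℝ≥0∞) + 1) := by
    rw [ENNReal.le_div_iff_mul_le (Or.inl hN.ne') (Or.inl hN'), mul_comm]
    exact h
  have hlt : evariance X μ < ⊤ :=
    lt_of_le_of_lt hev (ENNReal.div_lt_top ENNReal.ofReal_ne_top hN.ne')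
  have hLp : MemLp X 2 μ := (evariance_lt_top_iff_memLp hXm).1 hlt
  refine ⟨hLp, ?_⟩
  have hreal : (N : ℝ) + 1 = ((N : ℝ≥0∞) + 1).toReal := by
    rw [ENNReal.toReal_add (by simp) (by simp)]
    simp
  have hpos : 0 < (N : ℝ) + 1 := by positivity
  rw [le_div_iff₀ hpos, ← ENNReal.ofReal_le_ofReal_iff hC]
  calc ENNReal.ofReal (variance X μ * ((N : ℝ) + 1))
        = ENNReal.ofReal (variance X μ) * ENNReal.ofReal ((N : ℝ) + 1) :=
          ENNReal.ofReal_mul (variance_nonneg _ _)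
    _ = evariance X μ * ((N : ℝ≥0∞) + 1) := by
          rw [hLp.ofReal_variance_eq, hreal, ENNReal.ofReal_toReal hN']
    _ ≤ ENNReal.ofReal C := by rw [mul_comm]; exact h

/-- **Bienaymé–Chebyshev packaging.** If `(N+1)·eVar(X_N) ≤ C` for all `N` and the means
`E[X_N]` converge to `c`, then `X_N → c` in probability: `P_N(ε < |X_N - c|) → 0`. -/
theorem tendsto_measure_lt_abs_sub_of_evariance_le
    {P : (N : ℕ) → Measure (Ω N)} [∀ N, IsProbabilityMeasure (P N)]
    {X : (N : ℕ) → Ω N → ℝ} {c C : ℝ} (hXm : ∀ N, AEStronglyMeasurable (X N) (P N))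
    (hvar : ∀ N : ℕ, ((N : ℝ≥0∞) + 1) * evariance (X N) (P N) ≤ ENNReal.ofReal C)
    (hmean : Tendsto (fun N => ∫ ω, X N ω ∂P N) atTop (𝓝 c)) {ε : ℝ} (hε : 0 < ε) :
    Tendsto (fun N => P N {ω | ε < |X N ω - c|}) atTop (𝓝 0) := by
  -- WLOG `C ≥ 0` (otherwise replace it by `max C 0`)
  have hvar' : ∀ N : ℕ, ((N : ℝ≥0∞) + 1) * evariance (X N) (P N) ≤ ENNReal.ofReal (max C 0) :=
    fun N => (hvar N).trans (ENNReal.ofReal_le_ofReal (le_max_left _ _))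
  have hC0 : 0 ≤ max C 0 := le_max_right _ _
  have hη : 0 < ε / 2 := by positivity
  -- the Chebyshev rate
  have hrate : Tendsto (fun N : ℕ => ENNReal.ofReal (max C 0 / ((N : ℝ) + 1) / (ε / 2) ^ 2))
      atTop (𝓝 0) := by
    have h1 : Tendsto (fun N : ℕ => max C 0 / (ε / 2) ^ 2 * (1 / ((N : ℝ) + 1))) atTop
        (𝓝 (max C 0 / (ε / 2) ^ 2 * 0)) :=
      tendsto_one_div_add_atTop_nhds_zero_nat.const_mul _
    rw [mul_zero] at h1
    have h2 := ENNReal.tendsto_ofReal h1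
    rw [ENNReal.ofReal_zero] at h2
    refine h2.congr fun N => ?_
    congr 1
    field_simp
  -- eventually the mean is within `ε/2` of `c`
  have hm : ∀ᶠ N in atTop, |∫ ω, X N ω ∂P N - c| < ε / 2 := by
    have := (Metric.tendsto_atTop.1 hmean) (ε / 2) hη
    obtain ⟨N₀, hN₀⟩ := this
    exact eventually_atTop.2 ⟨N₀, fun N hN => by simpa [Real.dist_eq] using hN₀ N hN⟩
  refine tendsto_of_tendsto_of_tendsto_of_le_of_le' tendsto_const_nhds hrate
    (Eventually.of_forall fun N => zero_le) ?_
  filter_upwards [hm] with N hN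
  obtain ⟨hLp, hv⟩ := memLp_two_and_variance_le_of_evariance_le (hXm N) hC0 N (hvar' N)
  calc P N {ω | ε < |X N ω - c|}
      ≤ P N {ω | ε / 2 ≤ |X N ω - ∫ ω', X N ω' ∂P N|} := by
        refine measure_mono fun ω hω => ?_
        simp only [Set.mem_setOf_eq] at hω ⊢
        have := abs_sub_le (X N ω) (∫ ω', X N ω' ∂P N) c
        linarith
    _ ≤ ENNReal.ofReal (variance (X N) (P N) / (ε / 2) ^ 2) := meas_ge_le_variance_div_sq hLp hη
    _ ≤ ENNReal.ofReal (max C 0 / ((N : ℝ) + 1) / (ε / 2) ^ 2) :=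
        ENNReal.ofReal_le_ofReal (div_le_div_of_nonneg_right hv (by positivity))

/-- **Cauchy–Schwarz for the covariance**: for square-integrable `X`, `Y` on a probability space,
`|E[(X - E X)(Y - E Y)]| ≤ √Var X · √Var Y`. -/
theorem abs_integral_sub_mul_sub_le {α : Type*} [MeasurableSpace α] {μ : Measure α}
    [IsProbabilityMeasure μ] {X Y : α → ℝ} (hX : MemLp X 2 μ) (hY : MemLp Y 2 μ) :
    |∫ ω, (X ω - ∫ ω', X ω' ∂μ) * (Y ω - ∫ ω', Y ω' ∂μ) ∂μ| ≤
      Real.sqrt (variance X μ) * Real.sqrt (variance Y μ) := by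
  set f : α → ℝ := fun ω => X ω - ∫ ω', X ω' ∂μ with hf
  set g : α → ℝ := fun ω => Y ω - ∫ ω', Y ω' ∂μ with hg
  have hfL : MemLp f 2 μ := hX.sub (memLp_const _)
  have hgL : MemLp g 2 μ := hY.sub (memLp_const _)
  have hfa : MemLp (fun ω => |f ω|) (ENNReal.ofReal 2) μ := by
    rw [ENNReal.ofReal_ofNat]; exact hfL.abs
  have hga : MemLp (fun ω => |g ω|) (ENNReal.ofReal 2) μ := by
    rw [ENNReal.ofReal_ofNat]; exact hgL.abs
  have hH := integral_mul_le_Lp_mul_Lq_of_nonneg Real.HolderConjugate.two_two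
    (Eventually.of_forall fun ω => abs_nonneg (f ω)) (Eventually.of_forall fun ω => abs_nonneg (g ω))
    hfa hga
  have hvarX : variance X μ = ∫ ω, |f ω| ^ (2 : ℝ) ∂μ := by
    rw [variance_eq_integral hX.1.aemeasurable]
    refine integral_congr_ae (Eventually.of_forall fun ω => ?_)
    simp only [hf, Real.rpow_two, sq_abs]
  have hvarY : variance Y μ = ∫ ω, |g ω| ^ (2 : ℝ) ∂μ := by
    rw [variance_eq_integral hY.1.aemeasurable]
    refine integral_congr_ae (Eventually.of_forall fun ω => ?_)
    simp only [hg, Real.rpow_two, sq_abs]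
  calc |∫ ω, (X ω - ∫ ω', X ω' ∂μ) * (Y ω - ∫ ω', Y ω' ∂μ) ∂μ|
      = |∫ ω, f ω * g ω ∂μ| := rfl
    _ ≤ ∫ ω, |f ω * g ω| ∂μ := abs_integral_le_integral_abs
    _ = ∫ ω, |f ω| * |g ω| ∂μ := by simp_rw [abs_mul]
    _ ≤ (∫ ω, |f ω| ^ (2 : ℝ) ∂μ) ^ (1 / (2 : ℝ)) * (∫ ω, |g ω| ^ (2 : ℝ) ∂μ) ^ (1 / (2 : ℝ)) := hH
    _ = Real.sqrt (variance X μ) * Real.sqrt (variance Y μ) := by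
        rw [Real.sqrt_eq_rpow, Real.sqrt_eq_rpow, hvarX, hvarY]

end Summit.AtomisticToContinuum.HydrodynamicLimit.Theorems.AmplitudeTransfer
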